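import Summits.ResolutionOfSingularities.ResolutionOfSingularities.Theorems.EquisingularLiftEquisingularLiftNatERoundCartier
import Summits.ResolutionOfSingularities.ResolutionOfSingularities.Theorems.EquisingularLiftEquisingularLiftNatSectionRoundLiftRegular
import Summits.ResolutionOfSingularities.ResolutionOfSingularities.Theorems.EquisingularLiftEquisingularLiftNatEmbeddedCurveLiftOfFact
import Summits.ResolutionOfSingularities.ResolutionOfSingularities.Theorems.EquisingularLiftEquisingularLiftNatDoorFactsHold
import Summits.ResolutionOfSingularities.ResolutionOfSingularities.Theorems.EquisingularLiftEquisingularLiftNatPrefixPtRamStep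
import Summits.ResolutionOfSingularities.ResolutionOfSingularities.Theorems.EquisingularLiftEquisingularLiftNatPointPlaneModel
import Summits.ResolutionOfSingularities.ResolutionOfSingularities.Theorems.EquisingularLiftEquisingularLiftNatNodalHostedRoundOfCurveLift
import Literature.AlgebraicGeometry.Resolution.LogResolutionOfClosedSubset
import HarnessLib

/-!
# [OURS · L1 W4.5(b) · EL♮(3) · WIDTH TABLE D13 «(P-ram-Γ) / E-ROUND», supplier part 2] ★ THE E-ROUND LICENCE `ERound.eRoundLift`:
# a relative curve cut by ONE PARAMETER on the (possibly NON-REDUCED) trace of a REGULAR `O`-flat proper host lifts to a REGULAR `O`-flat centre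
# inside the host with EXACTLY the customer's trace

res-L1-w45b-stub-2 g20 (D13 supplier pen, desk R74b (d); binder of record `L/res-L1-w45b-stub-2/g20/ERound-licence-binder.txt` 2c9419fb1d0b4145).
OURS = this programme's construction; NOT a statement of any manuscript ([Hironaka2017] is a candidate under adjudication, nothing of it is asserted);
AI-written, weaker than expert review.  No `sorry`; standard axioms; DEF-FREE; HYPOTHESIS-FREE (✓ `embeddedLiftFact_holds` p704265 is a theorem).
`--supports stmt-ResolutionOfSingularities-20148 --as helper`, counted 0.

THE STATEMENT (lead-1 `E-ROUNDS.md` 6e4258499227b511 (3.1) in the chain's currency; idea-2 STATUS 2026-08-29T08:30:20Z for why the trace is not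
reduced).  Over an adically complete DVR `O ↠ k` with algebraically closed residue field: `X ⟶ P ⟶ Spec O` regular integral locally Noetherian with
`σ ≫ q` proper; a HOST MODEL `𝓔` on `X` — stalkwise principal, `≠ ⊥`, `V(𝓔)` regular, `O`-flat and proper (for the E-round: the exceptional divisor
`E_{L′} ≅ ℙ²_{O′}` of a RAM, by ✓ `pointPlane_model`'s clauses (e-ii)–(e-v)); the model square `j : G ⟶ X`; the host's TRACE `𝓙 = 𝓔·𝒪_G` (for the
E-round the e-fold plane `J·𝒪_{F₂}`, `e ≥ 2`); a CUSTOMER ideal `𝓘 ⊇ 𝓙` with (Γ1) `dim 𝒪_{V(𝓘),z} = 1` at closed points, (Γ2) `dim 𝒪_{V(𝓙),z} = 2` there,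
(PΓ) `𝓘_x = 𝓙_x + (f)` with `f ∉ 𝓙_x + 𝔪_x²` at closed `x ∈ supp 𝓘` («curvilinear-regular»), and (UΓ) the Čech clause of `EmbeddedLiftFact` for
`V(𝓘) ↪ V(𝓙)` (unobstructed).  THEN `∃ C ⊇ 𝓔` with `V(C)` REGULAR, `O`-FLAT and `C·𝒪_G = 𝓘`.

PROOF = the P0 skeleton of ✓ `embeddedCurveLiftFact_of_embeddedLiftFact_of_lci` (…NatEmbeddedCurveLiftOfFact :116–) with: the model square of
`W = V(𝓔)` read DIRECTLY on `W₀ = V(𝓔·𝒪_G)` (no reduced-trace iso); the lci clause = part 1 ★★ `ERound.exists_affineOpens_isWeaklyRegular_ker`;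
(F) = ✓ `embeddedLiftFact_holds`; transport (P3) verbatim; REGULARITY of `V(C)` = ✓ (u2) `SectionLift.isRegular_subscheme_of_paramLift` (p707813,
res-L1-w45b-nose-w1), whose hypotheses are already in `𝓔 ≤ C` / `comap` currency, fed (PΓ) through `C·𝒪_G = 𝓘`.
The REDUCED Σ-licence (`g20/HRoundSec-licence-binder.txt` 0196e0c85d2c112d, W₂) is the special case `𝓙 = 𝓘⟨E⟩`, `𝓘 = 𝓘⟨Z⟩`.
References (method only): R. Hartshorne, *Deformation Theory* (2010), Thm. 6.2 / 22.3 (through ✓ `embeddedLiftFact_holds`); H. Matsumura,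
*Commutative Ring Theory* (1986), Thm. 14.2, 23.7.

# — and, in the same module (400-line rule permitting; one farm olean lag fewer), supplier part 3 —
# ★ `TCPlus.pRamGamma_step`: THE RAMIFIED POINT STEP FOLLOWED BY THE PLANE ROUND IN ITS FRESH EXCEPTIONAL PLANE, at stage level
# (`HPRamGammaSupplier k 3`'s inhabitant, hostless output two stages down; desk R74c (2)–(3) / R75 (v))

STATEMENT = res-type-027's slot `HPRamGammaSupplier k n` (draft `DefsE7_D13_draft_v2.lean` f8a5defe854d7314 :102–:109) at `n = 3`, as an explicit
∀-statement (so that `TCPlus.hpramGamma_supplier k : HPRamGammaSupplier k 3 := TCPlus.pRamGamma_step k` once the slot is appended to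
✓ `…NatPrefixSupplierDefs`): ✓ `HPRamSupplier`'s context and RAM letters (a closed point `y` of `T̃₁` where neither `T̃₁` nor the ambient is regular, a
curvilinear fat point `J` at `pt = curvePt F₁ T₁ y` generated by three cotangent-independent elements, its blow-up `υ₂`), then the PLANE-ROUND letters on
the customer's CHOSEN ideal `𝓘 ⊇ J·𝒪_{F₂}` (support inside `St T₁`, non-empty; (Γ1) one-dimensional; (PΓ) curvilinear-regular; (UΓ) Čech-unobstructed —
the E-round licence binder `g20/ERound-licence-binder.txt` 2c9419fb1d0b4145 read with `𝓙 := J.comap υ₂`), its blow-up `υ₃`; OUTPUT: a new `Ch`-stage with a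
model square for `F₃` and running surface `St St T₁`, two stages down.

PROOF.  (1) ✓ `fatPointStep_model` (res-L1-w45b-stub-4 g11): the ram centre `C₁` (regular `O`-flat multisection, `C₁·𝒪_{F₁} = J`), `τ = Bl_{C₁}`, the new
stage `X″` with model square `j₂` (`j₂ ≫ τ = υ₂ ≫ j`).  (2) THE HOST MODEL of the fresh plane = the ram's exceptional divisor `𝓔 := C₁.comap τ`
(≅ `ℙ²_{O′}`): stalkwise principal (✓ `isPrincipal_stalkIdeal_comap_of_isBlowup`), `V(𝓔)` regular (Literature ✓ `IsBlowup.isRegular_subscheme_comap`),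
`O`-flat (✓ `flat_exceptional_of_isBlowup_regularCentre`), off the generic point of `Y` (✓ `image_support_comap_subset`), `≠ ⊥`, with TRACE
`𝓔·𝒪_{F₂} = J·𝒪_{F₂}` (`comap_comp` + `j₂ ≫ τ = υ₂ ≫ j`) — the e-FOLD plane, NOT reduced.  (3) (Γ2) «the trace is a surface» READ OFF by T-DIM:
★ `ringKrullDim_trace_stalk_eq_two_of_model` (✓ `ringKrullDim_redSub_stalk_eq_two_of_letter` in `hCD : 𝓔.comap j = 𝒟` currency).  (4) ★ part 2
`ERound.eRoundLift` ⟹ the round centre `C₂ ⊇ 𝓔`, regular, `O`-flat, `C₂·𝒪_{F₂} = 𝓘`.  (5) ✓ `modelStep_chain` with `D := 𝓘` (`¬ St T₁ ⊆ supp 𝓘` derived: `υ₂` is onto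
off `pt` by Literature ✓ `IsBlowup.exists_preimage_of_notMem_support`, and `supp 𝓘 ⊆ υ₂⁻¹ pt`).  lead-1's (3.2)/(F1) «`I_C·𝒪_T = I_{C₀}·𝒪_T`» is customer-side
and not used.  [cite: Liu2002, §8.1, Thm. 8.1.19] [cite: StacksProject, Tag 0805, Tag 02OS] [folklore; pure composition otherwise]
-/

set_option linter.dupNamespace false -- mandated namespace `Summit.<Summit>.<Problem>` of this single-conjunct summit
set_option linter.overlappingInstances false -- signatures carry `[IsDomain O] [IsDiscreteValuationRing O]`

noncomputable section

open CategoryTheory CategoryTheory.Limits AlgebraicGeometry TopologicalSpace Topology IsLocalRing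
open Literature.AlgebraicGeometry.Resolution
open AlgebraicGeometry.Scheme.IdealSheafData
open Literature.AlgebraicGeometry.Morphisms (CechMH1)
open Literature.AlgebraicGeometry.HodgeTheory (normalSheaf)
open Summit.ResolutionOfSingularities.ResolutionOfSingularities.Theses.EquisingularLift.Split
open Summit.ResolutionOfSingularities.ResolutionOfSingularities.Cruxes.EquisingularLift.StrataSplit

namespace Summit.ResolutionOfSingularities.ResolutionOfSingularities.Cruxes.EquisingularLiftNat.Sections.ERound

open Summit.ResolutionOfSingularities.ResolutionOfSingularities.Cruxes.EquisingularLiftNat.Sections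

set_option maxHeartbeats 800000 in -- long binder list and the transport bookkeeping
/-- ★ **THE E-ROUND LICENCE** (binder of record `g20/ERound-licence-binder.txt` 2c9419fb1d0b4145, VERBATIM): a relative curve cut by ONE PARAMETER on the
(possibly non-reduced) trace `V(𝓔·𝒪_G)` of a regular `O`-flat proper host `V(𝓔)`, one-dimensional, on a two-dimensional trace, with unobstructed
embedded deformations, lifts to a centre `C ⊇ 𝓔` with `V(C)` REGULAR, `O`-FLAT and `C·𝒪_G = 𝓘` EXACTLY.  See the module docstring.
[cite: Hartshorne2010, Thm. 22.3 — via ✓ `embeddedLiftFact_holds`] [OURS · D13 supplier part 2; counted 0; NOT a statement of the manuscript; EL♮(3) NOT proved] -/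
theorem eRoundLift (k : Type) [Field k] :
    ∀ (O : Type) [CommRing O] [IsDomain O] [IsDiscreteValuationRing O] [IsAdicComplete (maximalIdeal O) O]
        [IsAlgClosed (ResidueField O)] (θ : O →+* k), Function.Surjective θ →
      ∀ {P : Scheme.{0}} (X : Scheme.{0}) (σ : X ⟶ P) (q : P ⟶ Spec (.of O)) (𝓔 : X.IdealSheafData),
        IsIntegral X → IsLocallyNoetherian X → Scheme.IsRegular X → IsProper (σ ≫ q) →
        (∀ x : X, (stalkIdeal 𝓔 x).IsPrincipal) → 𝓔 ≠ ⊥ →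
        Scheme.IsRegular 𝓔.subscheme → Flat (𝓔.subschemeι ≫ σ ≫ q) → IsProper (𝓔.subschemeι ≫ σ ≫ q) →
        ∀ (G : Scheme.{0}) (j : G ⟶ X) (t : G ⟶ Spec (.of k)),
          IsPullback j t (σ ≫ q) (Spec.map (CommRingCat.ofHom θ)) →
          ∀ (𝓙 : G.IdealSheafData), 𝓔.comap j = 𝓙 →
          ∀ (𝓘 : G.IdealSheafData), 𝓙 ≤ 𝓘 →
            (∀ z : ↥𝓘.subscheme, IsClosed ({z} : Set ↥𝓘.subscheme) →
              ringKrullDim (𝓘.subscheme.presheaf.stalk z) = ((1 : ℕ) : WithBot ℕ∞)) →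
            (∀ (i : 𝓘.subscheme ⟶ 𝓙.subscheme), i ≫ 𝓙.subschemeι = 𝓘.subschemeι →
              ∀ z : ↥𝓘.subscheme, IsClosed ({z} : Set ↥𝓘.subscheme) →
                ringKrullDim (𝓙.subscheme.presheaf.stalk (i z)) = ((2 : ℕ) : WithBot ℕ∞)) →
            (∀ x ∈ (𝓘.support : Set G), IsClosed ({x} : Set G) → ∃ f : G.presheaf.stalk x,
              stalkIdeal 𝓘 x = stalkIdeal 𝓙 x ⊔ Ideal.span {f} ∧
                f ∉ stalkIdeal 𝓙 x ⊔ (maximalIdeal (G.presheaf.stalk x)) ^ 2) →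
            (∀ (i : 𝓘.subscheme ⟶ 𝓙.subscheme), i ≫ 𝓙.subschemeι = 𝓘.subschemeι →
              ∃ V : Fin 2 → (𝓘.subscheme).Opens, (∀ l, IsAffineOpen (V l)) ∧ IsAffineOpen (V 0 ⊓ V 1) ∧ ⨆ l, V l = ⊤ ∧
                Subsingleton (CechMH1 𝓘.subscheme.toSpecΓ (normalSheaf i) V)) →
            ∃ C : X.IdealSheafData, 𝓔 ≤ C ∧ Scheme.IsRegular C.subscheme ∧ Flat (C.subschemeι ≫ σ ≫ q) ∧
              C.comap j = 𝓘 := by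
  intro O _ _ _ _ _ θ hθ P X σ q 𝓔 hXint hXnoeth hXreg hσq hEpr h𝓔0 h𝓔reg h𝓔flat h𝓔prop G j t hsq 𝓙 h𝓙 𝓘 h𝓙𝓘 hΓ1 hΓ2 hPΓ hUΓ
  subst h𝓙
  haveI := hXint; haveI := hXnoeth; haveI := hσq
  haveI : IsLocallyNoetherian G := P1VB.isLocallyNoetherian_of_modelSquare θ hθ (σ ≫ q) j t hsq
  haveI : IsClosedImmersion (Spec.map (CommRingCat.ofHom θ)) := IsClosedImmersion.spec_of_surjective _ hθ
  haveI hjci : IsClosedImmersion j := MorphismProperty.IsStableUnderBaseChange.of_isPullback hsq.flip inferInstance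
  -- the special fibre `G` is proper over `Spec k`, hence quasi-compact
  haveI : IsProper t := MorphismProperty.IsStableUnderBaseChange.of_isPullback hsq inferInstance
  haveI : CompactSpace G := QuasiCompact.compactSpace_of_compactSpace t
  -- the ambient of (F): `W = V(𝓔)` over `Spec O`
  set w : 𝓔.subscheme ⟶ Spec (.of O) := 𝓔.subschemeι ≫ σ ≫ q with hw
  haveI : IsProper w := h𝓔prop
  haveI : Flat w := h𝓔flat
  haveI : IsLocallyNoetherian 𝓔.subscheme := LocallyOfFiniteType.isLocallyNoetherian 𝓔.subschemeι
  -- the inclusion of the customer's curve in the host's trace: `ι : V(𝓘) ⟶ V(𝓔·𝒪_G)`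
  let ι : 𝓘.subscheme ⟶ (𝓔.comap j).subscheme := inclusion h𝓙𝓘
  have hιfac : ι ≫ (𝓔.comap j).subschemeι = 𝓘.subschemeι := inclusion_subschemeι h𝓙𝓘
  haveI : IsClosedImmersion ι :=
    @IsClosedImmersion.of_comp_isClosedImmersion _ _ _ ι (𝓔.comap j).subschemeι inferInstance (by rw [hιfac]; infer_instance)
  haveI : IsLocallyNoetherian (𝓔.comap j).subscheme := LocallyOfFiniteType.isLocallyNoetherian (𝓔.comap j).subschemeι
  -- the model square of `W` with special fibre `V(𝓔·𝒪_G)` — read directly, no reduced-trace iso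
  let jW : (𝓔.comap j).subscheme ⟶ 𝓔.subscheme := subschemeComapHom j 𝓔
  let tW : (𝓔.comap j).subscheme ⟶ Spec (.of k) := (𝓔.comap j).subschemeι ≫ t
  have hsqW : IsPullback jW tW w (Spec.map (CommRingCat.ofHom θ)) := by
    rw [hw]; exact (isPullback_subschemeComapHom j 𝓔).paste_vert hsq
  have hsqj : IsPullback jW (𝓔.comap j).subschemeι 𝓔.subschemeι j := isPullback_subschemeComapHom j 𝓔
  -- the local complete intersection (part 1) and the Čech datum (UΓ)
  have hlci := exists_affineOpens_isWeaklyRegular_ker O θ hθ 𝓘 (𝓔.comap j) w jW tW hsqW h𝓔reg ι hιfac (hΓ2 ι hιfac) hΓ1 hPΓ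
  have hH1 := hUΓ ι hιfac
  -- apply (F) = ✓ `embeddedLiftFact_holds`
  obtain ⟨C₀, hC₀flat, hC₀comap⟩ :=
    embeddedLiftFact_holds O k θ hθ 𝓔.subscheme w (𝓔.comap j).subscheme jW tW hsqW inferInstance inferInstance 𝓘.subscheme ι
      inferInstance hlci hH1
  -- (P3) transport to `X`
  let f : C₀.subscheme ⟶ X := C₀.subschemeι ≫ 𝓔.subschemeι
  let C : X.IdealSheafData := C₀.map 𝓔.subschemeι
  have hCf : C = f.ker := rfl
  have hker : C₀.subschemeι.ker ≤ (ι ≫ jW).ker := by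
    rw [ker_subschemeι, ← map_ker, ← hC₀comap]; exact le_map_comap _ _
  let l : 𝓘.subscheme ⟶ C₀.subscheme := IsClosedImmersion.lift C₀.subschemeι (ι ≫ jW) hker
  have hlfac : l ≫ C₀.subschemeι = ι ≫ jW := IsClosedImmersion.lift_fac _ _ _
  have hsql : IsPullback ι l jW C₀.subschemeι :=
    isPullback_of_isClosedImmersion ι C₀.subschemeι l jW hlfac.symm (by rw [ker_subschemeι, hC₀comap])
  -- `V(𝓘) = V(C₀) ×_X G`
  have hsqG : IsPullback l (ι ≫ (𝓔.comap j).subschemeι) f j := hsql.flip.paste_vert hsqj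
  haveI : IsProper (C₀.subschemeι ≫ w) := inferInstance
  haveI : Flat (C₀.subschemeι ≫ w) := hC₀flat
  haveI hfci : IsClosedImmersion f := IsClosedImmersion.comp C₀.subschemeι 𝓔.subschemeι
  haveI : IsIso f.toImage := by infer_instance
  have h𝓔C : 𝓔 ≤ C :=
    calc 𝓔 = (⊥ : 𝓔.subscheme.IdealSheafData).map 𝓔.subschemeι := by rw [Scheme.IdealSheafData.map_bot, ker_subschemeι]
      _ ≤ C := map_mono _ bot_le
  -- `V(C) ≅ V(C₀)` over `X`: flatness and properness over `Spec O`
  have h1 : f.toImage ≫ C.subschemeι ≫ σ ≫ q = C₀.subschemeι ≫ w := by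
    change f.toImage ≫ f.imageι ≫ σ ≫ q = _
    rw [f.toImage_imageι_assoc, hw]; simp only [f, Category.assoc]
  haveI hCflat : Flat (C.subschemeι ≫ σ ≫ q) := by
    have h2 : Flat (f.toImage ≫ C.subschemeι ≫ σ ≫ q) := by rw [h1]; exact hC₀flat
    exact (MorphismProperty.cancel_left_of_respectsIso @Flat f.toImage _).mp h2
  haveI hCprop : IsProper (C.subschemeι ≫ σ ≫ q) := inferInstance
  -- the trace: `C·𝒪_G = 𝓘`
  have hCj : C.comap j = 𝓘 := by
    rw [hCf, ← ker_fst_of_isClosedImmersion f j, ← hsqG.flip.isoPullback_inv_fst, Scheme.Hom.ker_comp_of_isIso, hιfac, ker_subschemeι]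
  -- REGULARITY of `V(C)` by (u2), fed (PΓ) through the trace identity
  have hL2' : ∀ z₀ : G, z₀ ∈ ((C.comap j).support : Set G) → IsClosed ({z₀} : Set G) →
      ∃ g : G.presheaf.stalk z₀, stalkIdeal (C.comap j) z₀ = stalkIdeal (𝓔.comap j) z₀ ⊔ Ideal.span {g} ∧
        g ∉ stalkIdeal (𝓔.comap j) z₀ ⊔ maximalIdeal (G.presheaf.stalk z₀) ^ 2 := by
    rw [hCj]; exact hPΓ
  have hCreg : Scheme.IsRegular C.subscheme :=
    SectionLift.isRegular_subscheme_of_paramLift O k θ hθ (σ ≫ q) j t hsq 𝓔 C h𝓔C h𝓔reg hL2'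
  exact ⟨C, h𝓔C, hCreg, hCflat, hCj⟩

end Summit.ResolutionOfSingularities.ResolutionOfSingularities.Cruxes.EquisingularLiftNat.Sections.ERound

namespace Summit.ResolutionOfSingularities.ResolutionOfSingularities.Cruxes.EquisingularLiftNat.Sections

/-! ## (Γ2) read off by T-DIM, in trace currency -/

/-- ★ **(Γ2) READ OFF, TRACE CURRENCY** (✓ `ringKrullDim_redSub_stalk_eq_two_of_letter` with `hEtr : 𝓔.comap j = 𝓘⟨E⟩` generalised to `hCD : 𝓔.comap j = 𝒟`,
any ideal sheaf `𝒟` — e.g. the e-fold plane of a ram).  On a `Ch`-stage `X′` of the chain (`P/O` smooth proper of relative dimension `3`) with model square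
`(j, t)`, for `𝓔` with principal stalks, `𝓔 ≠ ⊥`, `V(𝓔)` flat over `O` and trace `𝓔·𝒪_{F} = 𝒟`: `dim 𝒪_{V(𝒟),z} = 2` at every closed point `z`.
[cite: Matsumura1987, Thm. 15.1, Thm. 13.5] [OURS · D13 supplier part 3] -/
theorem ringKrullDim_trace_stalk_eq_two_of_model (O : Type) [CommRing O] [IsDomain O] [IsDiscreteValuationRing O] (k : Type) [Field k]
    (θ : O →+* k) (hθ : Function.Surjective θ) {P : Scheme.{0}} [IsIntegral P] (q : P ⟶ Spec (.of O)) [SmoothOfRelativeDimension 3 q]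
    {Y : Set P} {ξ : P} (hξ : IsGenericPoint ξ Y) {X' : Scheme.{0}} {σ' : X' ⟶ P} {S' : Set X'} (hch : Chain P Y X' σ' S')
    [IsIntegral X'] [IsLocallyNoetherian X'] {F₁ : Scheme.{0}} (j : F₁ ⟶ X') (t : F₁ ⟶ Spec (.of k))
    (hsq : IsPullback j t (σ' ≫ q) (Spec.map (CommRingCat.ofHom θ)))
    (𝓔 : X'.IdealSheafData) (hEpr : ∀ x : X', (stalkIdeal 𝓔 x).IsPrincipal) (h𝓔0 : 𝓔 ≠ ⊥) [Flat (𝓔.subschemeι ≫ σ' ≫ q)]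
    {𝒟 : F₁.IdealSheafData} (hCD : 𝓔.comap j = 𝒟) :
    ∀ z : ↥𝒟.subscheme, IsClosed ({z} : Set ↥𝒟.subscheme) →
      ringKrullDim (𝒟.subscheme.presheaf.stalk z) = ((2 : ℕ) : WithBot ℕ∞) := by
  -- adapted from ✓ `ringKrullDim_redSub_stalk_eq_two_of_letter` (res-L1-w45b-stub-4 g14), `redSub` ↦ `𝒟.subscheme`
  intro z hz
  haveI : IsClosedImmersion (Spec.map (CommRingCat.ofHom θ)) := IsClosedImmersion.spec_of_surjective _ hθ
  haveI : IsClosedImmersion j := MorphismProperty.IsStableUnderBaseChange.of_isPullback hsq.flip inferInstance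
  set x : X' := j (𝒟.subschemeι z) with hx
  have hxcl : IsClosed ({x} : Set X') := by
    have h1 := (j.isClosedEmbedding.isClosedMap) _ ((𝒟.subschemeι.isClosedEmbedding.isClosedMap) _ hz)
    rwa [Set.image_singleton, Set.image_singleton] at h1
  have hxsp : (σ' ≫ q).base x = closedPoint O := by
    have h1 : x ∈ Set.range j := ⟨_, rfl⟩
    rw [range_eq_preimage_of_isPullback hsq, range_specMap_of_surjective_of_field θ hθ] at h1
    exact h1
  have hxsupp : x ∈ (𝓔.support : Set X') := by
    have h1 : 𝒟.subschemeι z ∈ ((𝓔.comap j).support : Set F₁) := by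
      rw [hCD, ← Scheme.IdealSheafData.range_subschemeι]; exact ⟨z, rfl⟩
    rw [Scheme.IdealSheafData.support_comap] at h1
    exact h1
  have hdimX : ringKrullDim (X'.presheaf.stalk x) = ((3 + 1 : ℕ) : WithBot ℕ∞) := ringKrullDim_stalk_eq_succ_of_chain q 3 hξ hch hxcl hxsp
  obtain ⟨g, hg⟩ := hEpr x
  have hg0 : g ≠ 0 := by
    intro h
    apply stalkIdeal_ne_bot_of_ne_bot h𝓔0 x
    rw [hg, h, Ideal.submodule_span_eq, Ideal.span_singleton_eq_bot]
  have hgm : g ∈ maximalIdeal (X'.presheaf.stalk x) := by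
    have hle := (mem_support_iff_stalkIdeal_le _ _).mp hxsupp
    exact hle (by rw [hg, Ideal.submodule_span_eq]; exact Ideal.mem_span_singleton_self g)
  have hquot : ringKrullDim (X'.presheaf.stalk x ⧸ stalkIdeal 𝓔 x) + 1 = ringKrullDim (X'.presheaf.stalk x) := by
    rw [hg, Ideal.submodule_span_eq]
    exact ringKrullDim_quotient_span_singleton_succ_eq_ringKrullDim_of_mem_nonZeroDivisors (mem_nonZeroDivisors_of_ne_zero hg0) hgm
  have hmodel := ringKrullDim_quotient_stalkIdeal_eq_of_model O k θ hθ (σ' ≫ q) j t hsq 𝓔 hCD z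
  rw [hmodel, hdimX] at hquot
  exact withBot_enat_cancel_one_one hquot

/-! ## The two-stage step -/

set_option maxHeartbeats 1600000 in -- long binder list, two model steps
/-- ★ **THE (P-ram-Γ) / E-ROUND STEP AT STAGE LEVEL** (`HPRamGammaSupplier k 3`'s text, res-type-027 draft f8a5defe854d7314, as an explicit statement):
ramified point step at a non-regular point of `T̃₁` (curvilinear fat point `J`, blow-up `υ₂`), then the plane round along the customer's `𝓘 ⊇ J·𝒪_{F₂}`
(one-dimensional, curvilinear-regular, Čech-unobstructed, blow-up `υ₃`) hosted by the ram's exceptional divisor `E_{L′} = V(C₁·𝒪_{X″})`; output the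
`Ch`-stage two steps down with its model square and running surface `St St T₁`.  See the module docstring for the five-step proof.
[cite: Liu2002, Thm. 8.1.19] [cite: StacksProject, Tag 02OS] [OURS · D13 supplier part 3; counted 0; NOT a statement of the manuscript; EL♮(3) NOT proved] -/
theorem TCPlus.pRamGamma_step (k : Type) [Field k] :
  ∀ (O : Type) [CommRing O] [IsDomain O] [IsDiscreteValuationRing O] [IsAdicComplete (IsLocalRing.maximalIdeal O) O] [IsAlgClosed (IsLocalRing.ResidueField O)] (θ : O →+* k), Function.Surjective θ →
    ∀ (P : Scheme.{0}) (q : P ⟶ Spec (.of O)) (Y : Set P) (Ch : ∀ X' : Scheme.{0}, (X' ⟶ P) → Set X' → Prop), (∀ (X' X'' : Scheme.{0}) (σ' : X' ⟶ P) (S' : Set X') (C : X'.IdealSheafData) (τ : X'' ⟶ X'), Ch X' σ' S' → IsBlowup τ C →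
        Scheme.IsRegular C.subscheme → Flat (C.subschemeι ≫ σ' ≫ q) → σ' '' (C.support : Set X') ⊆ {y | ¬ IsGenericPoint y Y} → (C.support : Set X') ∩ (σ' ≫ q) ⁻¹' {IsLocalRing.closedPoint O} ⊆ S' →
        Ch X'' (τ ≫ σ') (closure (τ ⁻¹' (S' \ (C.support : Set X'))))) → (∀ (X' : Scheme.{0}) (σ' : X' ⟶ P) (S' : Set X'), Ch X' σ' S' → Chain P Y X' σ' S') → Y ⊆ q ⁻¹' {IsLocalRing.closedPoint O} → IsIrreducible Y → IsClosed Y →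
      IsIntegral P → IsLocallyNoetherian P → Scheme.IsRegular P → IsProper q → SmoothOfRelativeDimension 3 q →
    ∀ (X' : Scheme.{0}) (σ' : X' ⟶ P) (S' : Set X'), Ch X' σ' S' → IsIntegral X' → IsLocallyNoetherian X' → Scheme.IsRegular X' → IsDominant (σ' ≫ q) → ∀ (F₁ : Scheme.{0}), IsIntegral F₁ → ∀ (j : F₁ ⟶ X') (t : F₁ ⟶ Spec (.of k)),
      IsPullback j t (σ' ≫ q) (Spec.map (CommRingCat.ofHom θ)) → ∀ (T₁ : Set F₁), IsClosed T₁ → IsIrreducible T₁ → j '' T₁ = S' →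
    ∀ (y : ↥(redSub F₁ (closure T₁) isClosed_closure)) (J : F₁.IdealSheafData) (F₂ : Scheme.{0}) (υ₂ : F₂ ⟶ F₁)
      (𝓘 : F₂.IdealSheafData) (F₃ : Scheme.{0}) (υ₃ : F₃ ⟶ F₂),
      ¬ IsRegularLocalRing ((redSub F₁ (closure T₁) isClosed_closure).presheaf.stalk y) →
      ¬ IsRegularLocalRing (F₁.presheaf.stalk (curvePt F₁ T₁ y)) →
      (J.support : Set F₁) = {curvePt F₁ T₁ y} →
      (∃ (ℓ : Fin 3 → F₁.presheaf.stalk (curvePt F₁ T₁ y)) (hℓ : ∀ i, ℓ i ∈ IsLocalRing.maximalIdeal (F₁.presheaf.stalk (curvePt F₁ T₁ y))),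
        stalkIdeal J (curvePt F₁ T₁ y) = Ideal.span (Set.range ℓ) ∧
        LinearIndependent (IsLocalRing.ResidueField (F₁.presheaf.stalk (curvePt F₁ T₁ y)))
          (fun i => (IsLocalRing.maximalIdeal (F₁.presheaf.stalk (curvePt F₁ T₁ y))).toCotangent ⟨ℓ i, hℓ i⟩)) →
      IsBlowup υ₂ J →
      J.comap υ₂ ≤ 𝓘 → (𝓘.support : Set F₂) ⊆ closure (υ₂ ⁻¹' (T₁ \ {curvePt F₁ T₁ y})) → (𝓘.support : Set F₂).Nonempty →
      (∀ z : ↥𝓘.subscheme, IsClosed ({z} : Set ↥𝓘.subscheme) → ringKrullDim (𝓘.subscheme.presheaf.stalk z) = ((1 : ℕ) : WithBot ℕ∞)) →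
      (∀ x ∈ (𝓘.support : Set F₂), IsClosed ({x} : Set F₂) → ∃ f : F₂.presheaf.stalk x,
        stalkIdeal 𝓘 x = stalkIdeal (J.comap υ₂) x ⊔ Ideal.span {f} ∧
          f ∉ stalkIdeal (J.comap υ₂) x ⊔ (maximalIdeal (F₂.presheaf.stalk x)) ^ 2) →
      (∀ (i : 𝓘.subscheme ⟶ (J.comap υ₂).subscheme), i ≫ (J.comap υ₂).subschemeι = 𝓘.subschemeι →
        ∃ V : Fin 2 → (𝓘.subscheme).Opens, (∀ l, IsAffineOpen (V l)) ∧ IsAffineOpen (V 0 ⊓ V 1) ∧ ⨆ l, V l = ⊤ ∧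
          Subsingleton (Literature.AlgebraicGeometry.Morphisms.CechMH1 𝓘.subscheme.toSpecΓ (Literature.AlgebraicGeometry.HodgeTheory.normalSheaf i) V)) →
      IsBlowup υ₃ 𝓘 →
      ∃ (X₉ : Scheme.{0}) (σ₉ : X₉ ⟶ P) (S₉ : Set X₉) (j₉ : F₃ ⟶ X₉) (t₉ : F₃ ⟶ Spec (.of k)), Ch X₉ σ₉ S₉ ∧ IsIntegral X₉ ∧ IsLocallyNoetherian X₉ ∧ Scheme.IsRegular X₉ ∧ IsDominant (σ₉ ≫ q) ∧
        IsPullback j₉ t₉ (σ₉ ≫ q) (Spec.map (CommRingCat.ofHom θ)) ∧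
        j₉ '' (closure (υ₃ ⁻¹' (closure (υ₂ ⁻¹' (T₁ \ {curvePt F₁ T₁ y})) \ (𝓘.support : Set F₂)))) = S₉ ∧
        IsClosed (closure (υ₃ ⁻¹' (closure (υ₂ ⁻¹' (T₁ \ {curvePt F₁ T₁ y})) \ (𝓘.support : Set F₂)))) ∧ IsIrreducible (closure (υ₃ ⁻¹' (closure (υ₂ ⁻¹' (T₁ \ {curvePt F₁ T₁ y})) \ (𝓘.support : Set F₂)))) ∧ IsIntegral F₃ := by
  intro O _ _ _ _ _ θ hθ P q Y Ch hStep hChain hYsp hYirr hYcl hPint hPnoeth hPreg hqprop hqsm X' σ' S' hCh hX'int hX'noeth hX'reg hdom F₁ hF₁ j t hsq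
    T₁ hT₁cl hT₁irr hTS y J F₂ υ₂ 𝓘 F₃ υ₃ hTreg hFreg hJsupp hJgen hυ₂ hJI hIT _hIne hΓ1 hPΓ hUΓ hυ₃
  classical
  haveI := hPint; haveI := hqprop; haveI := hqsm; haveI := hX'int; haveI := hX'noeth; haveI := hF₁
  -- the point of the ram
  have hyT : curvePt F₁ T₁ y ∈ T₁ := subschemeι_mem_of_isClosed hT₁cl y
  have hyc : IsClosed ({curvePt F₁ T₁ y} : Set F₁) := hJsupp ▸ J.support.isClosed
  have hTy : ¬ T₁ ⊆ {curvePt F₁ T₁ y} := not_subset_singleton_of_not_isRegularLocalRing_stalk y hTreg hyc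
  haveI : IsClosedImmersion (Spec.map (CommRingCat.ofHom θ)) := IsClosedImmersion.spec_of_surjective _ hθ
  haveI hjci : IsClosedImmersion j := MorphismProperty.IsStableUnderBaseChange.of_isPullback hsq.flip inferInstance
  have hjyc : IsClosed ({j (curvePt F₁ T₁ y)} : Set X') := by
    simpa only [Set.image_singleton] using hjci.isClosedEmbedding.isClosedMap _ hyc
  have hch : Chain P Y X' σ' S' := hChain _ _ _ hCh
  have hyoff : ¬ IsGenericPoint (σ' (j (curvePt F₁ T₁ y))) Y :=
    not_isGenericPoint_of_image_eq hch j hjci.isClosedEmbedding.injective hTS hjyc hTy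
  -- (1) the RAM: ✓ `fatPointStep_model`, keeping the centre `C₁` and `τ`
  obtain ⟨ℓ, hℓ, hJℓ, hli⟩ := hJgen
  obtain ⟨C₁, X'', τ, j₂, t₂, hτ, hC₁j, hC₁reg, hC₁fl, hC₁sp, -, hCh'', hreg'', hnoeth'', hint'', hdom'', hprop'', -, -, hF₂int, hF₂noeth, hT₂irr,
      hsq₂, hcomm, hsets⟩ :=
    fatPointStep_model O k θ hθ P q Y hYsp hYirr hYcl hPnoeth hPreg 3 Ch hChain hStep X' σ' S' hCh hdom F₁ j t hsq T₁ hTS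
      (curvePt F₁ T₁ y) hyT hTy hyoff J hJsupp ℓ hℓ hJℓ hli F₂ υ₂ hυ₂
  haveI := hnoeth''; haveI := hint''; haveI := hF₂int; haveI := hF₂noeth
  have hsq₂' : IsPullback j₂ t₂ ((τ ≫ σ') ≫ q) (Spec.map (CommRingCat.ofHom θ)) := hsq₂
  have hprop''' : IsProper ((τ ≫ σ') ≫ q) := hprop''
  have hch'' : Chain P Y X'' (τ ≫ σ') (closure (τ ⁻¹' (S' \ (C₁.support : Set X')))) := hChain _ _ _ hCh''
  -- the ram centre is off the generic point of `Y`
  have hC₁off : σ' '' (C₁.support : Set X') ⊆ {p : P | ¬ IsGenericPoint p Y} := by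
    rintro _ ⟨x, hx, rfl⟩ hgen
    by_cases hxs : (σ' ≫ q).base x = closedPoint O
    · have hx1 : x ∈ (C₁.support : Set X') ∩ (σ' ≫ q) ⁻¹' {closedPoint O} := ⟨hx, hxs⟩
      rw [hC₁sp] at hx1
      rw [Set.mem_singleton_iff.mp hx1] at hgen
      exact hyoff hgen
    · apply hxs
      have hY : σ' x ∈ Y := hgen.mem
      have h2 : q (σ' x) = closedPoint O := hYsp hY
      simpa only [Scheme.Hom.comp_base, TopCat.coe_comp, Function.comp_apply] using h2
  -- (2) THE HOST MODEL of the fresh plane: the ram's exceptional divisor `𝓔 := C₁·𝒪_{X″}`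
  set 𝓔 : X''.IdealSheafData := C₁.comap τ with h𝓔def
  have hEpr : ∀ x : X'', (stalkIdeal 𝓔 x).IsPrincipal := isPrincipal_stalkIdeal_comap_of_isBlowup C₁ hτ
  have h𝓔reg : Scheme.IsRegular 𝓔.subscheme := hτ.isRegular_subscheme_comap hX'reg hC₁reg
  have h𝓔fl0 := flat_exceptional_of_isBlowup_regularCentre O X' X'' (σ' ≫ q) C₁ hX'reg hC₁reg hC₁fl τ hτ
  have h𝓔flat : Flat (𝓔.subschemeι ≫ (τ ≫ σ') ≫ q) := by simpa only [Category.assoc] using h𝓔fl0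
  haveI : IsProper ((τ ≫ σ') ≫ q) := hprop''
  have h𝓔prop : IsProper (𝓔.subschemeι ≫ (τ ≫ σ') ≫ q) := inferInstance
  have hEoff : (τ ≫ σ') '' (𝓔.support : Set X'') ⊆ {p : P | ¬ IsGenericPoint p Y} := image_support_comap_subset C₁ τ σ' hC₁off
  -- `𝓔 ≠ ⊥`: the fibre of the new stage over the generic point of `Y` is off `supp 𝓔`
  obtain ⟨ξ, hξ⟩ : ∃ ξ : P, IsGenericPoint ξ Y := QuasiSober.sober hYirr hYcl
  have h𝓔0 : 𝓔 ≠ ⊥ := by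
    obtain ⟨ξ', hfib', -⟩ := Chain.fibre hch'' hξ
    intro h0
    have hmem : ξ' ∈ (𝓔.support : Set X'') := by rw [h0, Scheme.IdealSheafData.support_bot]; trivial
    have hgen : (τ ≫ σ') ξ' = ξ := by
      have : ξ' ∈ (τ ≫ σ') ⁻¹' {ξ} := by rw [hfib']; exact Set.mem_singleton ξ'
      exact this
    exact hEoff ⟨ξ', hmem, rfl⟩ (hgen ▸ hξ)
  -- the TRACE of the host: the e-fold plane `J·𝒪_{F₂}`
  have h𝓙 : 𝓔.comap j₂ = J.comap υ₂ := by
    rw [h𝓔def, ← Scheme.IdealSheafData.comap_comp, hcomm, Scheme.IdealSheafData.comap_comp, hC₁j]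
  -- (3) (Γ2): the trace is a surface at the closed points of `V(𝓘)`
  haveI : Flat (𝓔.subschemeι ≫ (τ ≫ σ') ≫ q) := h𝓔flat
  have hΓ2 : ∀ (i : 𝓘.subscheme ⟶ (J.comap υ₂).subscheme), i ≫ (J.comap υ₂).subschemeι = 𝓘.subschemeι →
      ∀ z : ↥𝓘.subscheme, IsClosed ({z} : Set ↥𝓘.subscheme) →
        ringKrullDim ((J.comap υ₂).subscheme.presheaf.stalk (i z)) = ((2 : ℕ) : WithBot ℕ∞) := by
    intro i hi z hz
    refine ringKrullDim_trace_stalk_eq_two_of_model O k θ hθ q hξ hch'' j₂ t₂ hsq₂' 𝓔 hEpr h𝓔0 h𝓙 (i z) ?_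
    have hzF : IsClosed ({𝓘.subschemeι z} : Set F₂) := by
      have h1 := (𝓘.subschemeι.isClosedEmbedding.isClosedMap) _ hz
      rwa [Set.image_singleton] at h1
    have h1 : ({i z} : Set ↥(J.comap υ₂).subscheme) = (J.comap υ₂).subschemeι ⁻¹' {𝓘.subschemeι z} := by
      ext s'
      simp only [Set.mem_singleton_iff, Set.mem_preimage]
      constructor
      · intro h; rw [h, ← Scheme.Hom.comp_apply, hi]
      · intro h
        apply (J.comap υ₂).subschemeι.isClosedEmbedding.injective
        rw [h, ← Scheme.Hom.comp_apply, hi]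
    rw [h1]; exact hzF.preimage (J.comap υ₂).subschemeι.continuous
  -- (4) THE E-ROUND LICENCE at the host model
  obtain ⟨C₂, h𝓔C₂, hC₂reg, hC₂fl, hC₂j⟩ :=
    ERound.eRoundLift k O θ hθ X'' (τ ≫ σ') q 𝓔 hint'' hnoeth'' hreg'' hprop''' hEpr h𝓔0 h𝓔reg h𝓔flat h𝓔prop F₂ j₂ t₂ hsq₂'
      (J.comap υ₂) h𝓙 𝓘 hJI hΓ1 hΓ2 hPΓ hUΓ
  -- (5) the second model step: blow up `C₂` over `υ₃ = Bl_𝓘`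
  have hC₂off : (τ ≫ σ') '' (C₂.support : Set X'') ⊆ {p : P | ¬ IsGenericPoint p Y} := by
    rintro _ ⟨x, hx, rfl⟩
    exact hEoff ⟨x, Scheme.IdealSheafData.support_antitone h𝓔C₂ hx, rfl⟩
  -- `¬ St T₁ ⊆ supp 𝓘`: `υ₂` is onto off the point, and `supp 𝓘` lies in the fresh plane
  have hTD : ¬ closure (υ₂ ⁻¹' (T₁ \ {curvePt F₁ T₁ y})) ⊆ (𝓘.support : Set F₂) := by
    intro hsub
    obtain ⟨w, hwT, hwy⟩ : ∃ w ∈ T₁, w ∉ ({curvePt F₁ T₁ y} : Set F₁) := Set.not_subset.mp hTy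
    have hwJ : w ∉ (J.support : Set F₁) := by rw [hJsupp]; exact hwy
    obtain ⟨w', hw'⟩ := hυ₂.exists_preimage_of_notMem_support hwJ
    have hw'T : w' ∈ closure (υ₂ ⁻¹' (T₁ \ {curvePt F₁ T₁ y})) := subset_closure (by
      show υ₂ w' ∈ T₁ \ {curvePt F₁ T₁ y}
      rw [hw']; exact ⟨hwT, hwy⟩)
    have hw'I : w' ∈ ((J.comap υ₂).support : Set F₂) := Scheme.IdealSheafData.support_antitone hJI (hsub hw'T)
    rw [Scheme.IdealSheafData.support_comap] at hw'I
    apply hwJ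
    have : υ₂ w' ∈ (J.support : Set F₁) := hw'I
    rwa [hw'] at this
  obtain ⟨X₃, τ₃, hτ₃⟩ := exists_isBlowup X'' C₂
  obtain ⟨hX₃i, hX₃n, hX₃r, hX₃dom, hF₃i, hirr₃, j₃, t₃, hsq₃, -, hCh₃⟩ :=
    modelStep_chain O k θ hθ P q Y hYirr hYcl Ch hChain hStep X'' (τ ≫ σ') (closure (τ ⁻¹' (S' \ (C₁.support : Set X')))) hCh'' hreg'' hdom''
      F₂ j₂ t₂ hsq₂' (closure (υ₂ ⁻¹' (T₁ \ {curvePt F₁ T₁ y}))) hsets C₂ 𝓘 hC₂j hC₂reg hC₂fl hC₂off hIT hTD X₃ τ₃ hτ₃ F₃ υ₃ hυ₃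
  refine ⟨X₃, (τ₃ ≫ τ ≫ σ'), _, j₃, t₃, ?_, hX₃i, hX₃n, hX₃r, ?_, ?_, rfl, isClosed_closure, hirr₃, hF₃i⟩
  · simpa only [Category.assoc] using hCh₃
  · simpa only [Category.assoc] using hX₃dom
  · simpa only [Category.assoc] using hsq₃

end Summit.ResolutionOfSingularities.ResolutionOfSingularities.Cruxes.EquisingularLiftNat.Sections

end
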